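import Mathlib.Analysis.SpecialFunctions.Trigonometric.DerivHyp
import Mathlib.Algebra.BigOperators.Ring.Finset
import Mathlib.Tactic
import HarnessLib

/-!
# Bethe-threshold subharmonicity of Ising correlations — the abstract core inequality
# (crux `SubharmonicOffOrigin`, stmt-CriticalPhenomena-1341, route PerfectScreening; by-product)

Pure finite algebra behind the Bethe-threshold lattice subharmonicity of Ising correlations off
the source (companion file `PerfectScreeningSubharmonicOffOriginBetheThreshold.lean`, which applies
it to the nearest-neighbour Ising model on an arbitrary graph and to the plus state of `ℤ^d`).

`bethe_core`: let `Ω` be a finite set of "outer" configurations carrying a weight `E`, an observable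
`g` and `±1`-valued spins `s_y`, `y ∈ N` (`n = #N`), such that all moments `Σ_ω E g ∏_{y∈T} s_y`
(`T ⊆ N`) are nonnegative — the first Griffiths inequality of the outer (x-deleted) system.  Then
for `β ≥ 0` with `(n − 1)·tanh β ≤ 1`,
`n · Σ_ω E g sinh(β h) ≤ Σ_{y∈N} Σ_ω E g s_y cosh(β h)`, `h = Σ_{y∈N} s_y`.

Proof: expand `e^{±βh} = cosh^n β · Σ_{S⊆N} (±t)^{#S} σ_S` (`t = tanh β`, `σ_S = ∏_{y∈S} s_y`,
`s_y = ±1`; the finite high-temperature expansion, Friedli–Velenik 2017 eq. (3.44)), so that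
`n·sinh(βh) = cosh^n β Σ_T n·o_T σ_T` and, after the reindexing `S ↦ S ∆ {y}`,
`Σ_y s_y cosh(βh) = cosh^n β Σ_T (Σ_{y∈N} e_{T∆{y}}) σ_T` with `o_T = (t^{#T} − (−t)^{#T})/2`,
`e_S = (t^{#S} + (−t)^{#S})/2`; the coefficients compare (`#T = k` odd:
`k t^{k−1} + (n−k) t^{k+1} − n t^k = t^{k−1}(1−t)(k − (n−k)t) ≥ 0` when `(n−1)t ≤ 1`; `#T` even:
`o_T = 0 ≤ e`), and the moments `Σ_ω E g σ_T` are nonnegative by hypothesis.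

References: S. Friedli, Y. Velenik, *Statistical Mechanics of Lattice Systems* (CUP 2017), §3.7.3
eq. (3.44) and Thm. 3.49 [FriedliVelenik2017].  Helper of stmt-CriticalPhenomena-1341
(`--supports`); no definition, no named fact.
-/

noncomputable section

open Finset

namespace Summit.CriticalPhenomena.Ising3DConformalLimit.Theorems.PerfectScreening.Bethe


/-- High-temperature expansion of a single Boltzmann factor: for `±1`-valued `s y ω` (`y ∈ N`),
`exp (K ∑_{y∈N} s_y) = cosh(K)^{#N} ∑_{S ⊆ N} tanh(K)^{#S} ∏_{y∈S} s_y`. -/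
private theorem betheCore_exp_expand {Ω W : Type*} (s : W → Ω → ℝ) (N : Finset W) (ω : Ω)
    (hs : ∀ y ∈ N, s y ω = 1 ∨ s y ω = -1) (K : ℝ) :
    Real.exp (K * ∑ y ∈ N, s y ω) =
      Real.cosh K ^ #N * ∑ S ∈ N.powerset, Real.tanh K ^ #S * ∏ y ∈ S, s y ω := by
  have hct : Real.cosh K * Real.tanh K = Real.sinh K := by
    rw [Real.tanh_eq_sinh_div_cosh]
    exact mul_div_cancel₀ _ (Real.cosh_pos K).ne'
  have h1 : ∀ y ∈ N, Real.exp (K * s y ω) = Real.cosh K * (1 + Real.tanh K * s y ω) := by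
    intro y hy
    rcases hs y hy with h | h
    · rw [h, mul_one, mul_one, mul_add, mul_one, hct, Real.cosh_add_sinh]
    · rw [h, mul_neg_one, mul_neg_one, ← sub_eq_add_neg, mul_sub, mul_one, hct,
        Real.cosh_sub_sinh]
  rw [Finset.mul_sum, Real.exp_sum, Finset.prod_congr rfl h1, Finset.prod_mul_distrib,
    Finset.prod_const, Finset.prod_one_add]
  congr 1
  refine Finset.sum_congr rfl fun S _ => ?_
  rw [Finset.prod_mul_distrib, Finset.prod_const]

/-- Expansion of `sinh (β h)`, `h = ∑_{y∈N} s_y`: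
`sinh (β h) = cosh(β)^{#N} ∑_{S ⊆ N} ((t^{#S} - (-t)^{#S})/2) ∏_{y∈S} s_y`, `t = tanh β`. -/
private theorem betheCore_sinh_expand {Ω W : Type*} (s : W → Ω → ℝ) (N : Finset W) (ω : Ω)
    (hs : ∀ y ∈ N, s y ω = 1 ∨ s y ω = -1) (β : ℝ) :
    Real.sinh (β * ∑ y ∈ N, s y ω) =
      Real.cosh β ^ #N * ∑ S ∈ N.powerset,
        (Real.tanh β ^ #S - (-Real.tanh β) ^ #S) / 2 * ∏ y ∈ S, s y ω := by
  have hpos := betheCore_exp_expand s N ω hs β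
  have hneg := betheCore_exp_expand s N ω hs (-β)
  rw [Real.cosh_neg, Real.tanh_neg, neg_mul] at hneg
  rw [Real.sinh_eq, hpos, hneg, ← mul_sub, ← Finset.sum_sub_distrib, mul_div_assoc,
    Finset.sum_div]
  congr 1
  refine Finset.sum_congr rfl fun S _ => ?_
  ring

/-- The reindexing `S ↦ S ∆ {y}` of the subsets of `N`: for `y ∈ N` and `σ_y² = 1`,
`σ_y ∑_{S ⊆ N} a(#S) σ_S = ∑_{T ⊆ N} a'(T) σ_T`, where `a'(T) = a(#T - 1)` if `y ∈ T` and
`a'(T) = a(#T + 1)` otherwise. -/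
private theorem betheCore_reindex {W : Type*} [DecidableEq W] (N : Finset W) (σ : W → ℝ)
    {y : W} (hy : y ∈ N) (hσy : σ y * σ y = 1) (a : ℕ → ℝ) :
    σ y * ∑ S ∈ N.powerset, a #S * ∏ z ∈ S, σ z =
      ∑ T ∈ N.powerset, (if y ∈ T then a (#T - 1) else a (#T + 1)) * ∏ z ∈ T, σ z := by
  obtain ⟨N', hyN', rfl⟩ : ∃ N', y ∉ N' ∧ insert y N' = N :=
    ⟨N.erase y, Finset.notMem_erase y N, Finset.insert_erase hy⟩
  have hmem : ∀ S ∈ N'.powerset, y ∉ S := fun S hS h => hyN' (Finset.mem_powerset.mp hS h)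
  rw [Finset.mul_sum, Finset.sum_powerset_insert hyN', Finset.sum_powerset_insert hyN',
    ← Finset.sum_add_distrib, ← Finset.sum_add_distrib]
  refine Finset.sum_congr rfl fun S hS => ?_
  rw [if_neg (hmem S hS), if_pos (Finset.mem_insert_self y S), Finset.prod_insert (hmem S hS),
    Finset.card_insert_of_notMem (hmem S hS), Nat.add_sub_cancel]
  linear_combination (a (#S + 1) * ∏ z ∈ S, σ z) * hσy

/-- Expansion of `s_y cosh (β h)` for `y ∈ N`, `h = ∑_{z∈N} s_z`, `t = tanh β`:
`s_y cosh (β h) = cosh(β)^{#N} ∑_{T ⊆ N} e'_y(T) ∏_{z∈T} s_z` with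
`e'_y(T) = (t^{#T-1} + (-t)^{#T-1})/2` if `y ∈ T` and `(t^{#T+1} + (-t)^{#T+1})/2` otherwise. -/
private theorem betheCore_spin_cosh_expand {Ω W : Type*} [DecidableEq W] (s : W → Ω → ℝ)
    (N : Finset W) (ω : Ω) (hs : ∀ y ∈ N, s y ω = 1 ∨ s y ω = -1) (β : ℝ) {y : W}
    (hy : y ∈ N) :
    s y ω * Real.cosh (β * ∑ z ∈ N, s z ω) =
      Real.cosh β ^ #N * ∑ T ∈ N.powerset,
        (if y ∈ T then (Real.tanh β ^ (#T - 1) + (-Real.tanh β) ^ (#T - 1)) / 2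
          else (Real.tanh β ^ (#T + 1) + (-Real.tanh β) ^ (#T + 1)) / 2) * ∏ z ∈ T, s z ω := by
  have hpos := betheCore_exp_expand s N ω hs β
  have hneg := betheCore_exp_expand s N ω hs (-β)
  rw [Real.cosh_neg, Real.tanh_neg, neg_mul] at hneg
  have hcosh : Real.cosh (β * ∑ z ∈ N, s z ω) =
      Real.cosh β ^ #N * ∑ S ∈ N.powerset,
        (Real.tanh β ^ #S + (-Real.tanh β) ^ #S) / 2 * ∏ z ∈ S, s z ω := by
    rw [Real.cosh_eq, hpos, hneg, ← mul_add, ← Finset.sum_add_distrib, mul_div_assoc,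
      Finset.sum_div]
    congr 1
    refine Finset.sum_congr rfl fun S _ => ?_
    ring
  have hσy : s y ω * s y ω = 1 := by
    rcases hs y hy with h | h <;> rw [h] <;> norm_num
  rw [hcosh, mul_left_comm,
    betheCore_reindex N (fun z => s z ω) hy hσy
      (fun k => (Real.tanh β ^ k + (-Real.tanh β) ^ k) / 2)]

/-- `0 ≤ (t^m + (-t)^m)/2` for `0 ≤ t`. -/
private theorem betheCore_ev_nonneg {t : ℝ} (ht : 0 ≤ t) (m : ℕ) :
    0 ≤ (t ^ m + (-t) ^ m) / 2 := by
  rcases Nat.even_or_odd m with h | h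
  · rw [h.neg_pow]
    positivity
  · rw [h.neg_pow, add_neg_cancel, zero_div]

/-- The coefficient inequality: for `T ⊆ N`, `0 ≤ t ≤ 1` and `(#N - 1) t ≤ 1`,
`#N · (t^{#T} - (-t)^{#T})/2 ≤ ∑_{y∈N} e'_y(T)`. -/
private theorem betheCore_coeff {W : Type*} [DecidableEq W] {N T : Finset W} (hT : T ⊆ N)
    {t : ℝ} (ht0 : 0 ≤ t) (ht1 : t ≤ 1) (ht : ((#N : ℝ) - 1) * t ≤ 1) :
    (#N : ℝ) * ((t ^ #T - (-t) ^ #T) / 2) ≤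
      ∑ y ∈ N, (if y ∈ T then (t ^ (#T - 1) + (-t) ^ (#T - 1)) / 2
        else (t ^ (#T + 1) + (-t) ^ (#T + 1)) / 2) := by
  rw [← Finset.sum_sdiff hT,
    Finset.sum_ite_of_false (s := N \ T) (p := fun y => y ∈ T)
      (fun y hy => (Finset.mem_sdiff.mp hy).2),
    Finset.sum_ite_of_true (s := T) (p := fun y => y ∈ T) (fun y hy => hy),
    Finset.sum_const, Finset.sum_const, nsmul_eq_mul, nsmul_eq_mul,
    Finset.card_sdiff_of_subset hT, Nat.cast_sub (Finset.card_le_card hT)]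
  have hTN : (#T : ℝ) ≤ #N := by exact_mod_cast Finset.card_le_card hT
  rcases Nat.even_or_odd #T with hk | hk
  · rw [hk.neg_pow, sub_self, zero_div, mul_zero]
    exact add_nonneg (mul_nonneg (sub_nonneg.mpr hTN) (betheCore_ev_nonneg ht0 _))
      (mul_nonneg (Nat.cast_nonneg _) (betheCore_ev_nonneg ht0 _))
  · have hk1 : 1 ≤ #T := by
      obtain ⟨j, hj⟩ := hk
      omega
    have he1 : Even (#T - 1) := by
      obtain ⟨j, hj⟩ := hk
      exact ⟨j, by omega⟩
    have he2 : Even (#T + 1) := hk.add_one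
    rw [hk.neg_pow, he1.neg_pow, he2.neg_pow, sub_neg_eq_add]
    have hp1 : t ^ #T = t ^ (#T - 1) * t := by
      rw [← pow_succ, Nat.sub_add_cancel hk1]
    have hp2 : t ^ (#T + 1) = t ^ (#T - 1) * t * t := by
      rw [pow_succ, hp1]
    rw [hp2, hp1]
    have hm : 0 ≤ t ^ (#T - 1) := pow_nonneg ht0 _
    have hk1' : (1 : ℝ) ≤ #T := by exact_mod_cast hk1
    have hP : 0 ≤ t ^ (#T - 1) *
        ((1 - t) * ((1 - ((#N : ℝ) - 1) * t) + ((#T : ℝ) - 1) * (1 + t))) := by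
      apply mul_nonneg hm
      apply mul_nonneg (sub_nonneg.mpr ht1)
      have : 0 ≤ ((#T : ℝ) - 1) * (1 + t) := mul_nonneg (sub_nonneg.mpr hk1') (by linarith)
      linarith
    linarith [hP]

/-- **Core inequality.** Let `Ω` be a finite set of "outer" configurations with a weight `E`, an
observable `g` and `±1`-valued spins `s y`, `y ∈ N` (`#N = n`), such that every
`∑_ω E g ∏_{y∈T} s_y ≥ 0` (`T ⊆ N`; first Griffiths inequality of the outer system). Then for
`β ≥ 0` with `(n − 1) tanh β ≤ 1`,
`n ∑_ω E g sinh(β h) ≤ ∑_{y∈N} ∑_ω E g s_y cosh(β h)`, `h = ∑_{y∈N} s_y`. -/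
theorem bethe_core : ∀ {Ω W : Type*} [Fintype Ω] [DecidableEq W] (E g : Ω → ℝ) (s : W → Ω → ℝ) (N : Finset W), (∀ y ∈ N, ∀ ω, s y ω = 1 ∨ s y ω = -1) → (∀ T ⊆ N, 0 ≤ ∑ ω, E ω * g ω * ∏ y ∈ T, s y ω) → ∀ {β : ℝ}, 0 ≤ β → ((#N : ℝ) - 1) * Real.tanh β ≤ 1 → (#N : ℝ) * ∑ ω, E ω * g ω * Real.sinh (β * ∑ y ∈ N, s y ω) ≤ ∑ y ∈ N, ∑ ω, E ω * g ω * s y ω * Real.cosh (β * ∑ z ∈ N, s z ω) := by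
  intro Ω W _ _ E g s N hs hGKS β hβ ht
  have ht0 : 0 ≤ Real.tanh β := by
    rw [Real.tanh_eq_sinh_div_cosh]
    exact div_nonneg (Real.sinh_nonneg_iff.mpr hβ) (Real.cosh_pos β).le
  have ht1 : Real.tanh β ≤ 1 := (Real.tanh_lt_one β).le
  have hc0 : 0 ≤ Real.cosh β ^ #N := pow_nonneg (Real.cosh_pos β).le _
  -- expansion of the left-hand side
  have hL : ∑ ω, E ω * g ω * Real.sinh (β * ∑ y ∈ N, s y ω) =
      Real.cosh β ^ #N * ∑ S ∈ N.powerset,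
        (Real.tanh β ^ #S - (-Real.tanh β) ^ #S) / 2 * ∑ ω, E ω * g ω * ∏ y ∈ S, s y ω := by
    calc ∑ ω, E ω * g ω * Real.sinh (β * ∑ y ∈ N, s y ω)
        = ∑ ω, ∑ S ∈ N.powerset, Real.cosh β ^ #N *
            ((Real.tanh β ^ #S - (-Real.tanh β) ^ #S) / 2 *
              (E ω * g ω * ∏ y ∈ S, s y ω)) := by
          refine Finset.sum_congr rfl fun ω _ => ?_
          rw [betheCore_sinh_expand s N ω (fun y hy => hs y hy ω) β, Finset.mul_sum,
            Finset.mul_sum]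
          refine Finset.sum_congr rfl fun S _ => ?_
          ring
      _ = Real.cosh β ^ #N * ∑ S ∈ N.powerset,
            (Real.tanh β ^ #S - (-Real.tanh β) ^ #S) / 2 *
              ∑ ω, E ω * g ω * ∏ y ∈ S, s y ω := by
          rw [Finset.sum_comm, Finset.mul_sum]
          refine Finset.sum_congr rfl fun S _ => ?_
          rw [Finset.mul_sum, Finset.mul_sum]
  -- expansion of the right-hand side
  have hR : ∀ y ∈ N, ∑ ω, E ω * g ω * s y ω * Real.cosh (β * ∑ z ∈ N, s z ω) =
      Real.cosh β ^ #N * ∑ T ∈ N.powerset,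
        (if y ∈ T then (Real.tanh β ^ (#T - 1) + (-Real.tanh β) ^ (#T - 1)) / 2
          else (Real.tanh β ^ (#T + 1) + (-Real.tanh β) ^ (#T + 1)) / 2) *
          ∑ ω, E ω * g ω * ∏ z ∈ T, s z ω := by
    intro y hy
    calc ∑ ω, E ω * g ω * s y ω * Real.cosh (β * ∑ z ∈ N, s z ω)
        = ∑ ω, ∑ T ∈ N.powerset, Real.cosh β ^ #N *
            ((if y ∈ T then (Real.tanh β ^ (#T - 1) + (-Real.tanh β) ^ (#T - 1)) / 2
              else (Real.tanh β ^ (#T + 1) + (-Real.tanh β) ^ (#T + 1)) / 2) *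
              (E ω * g ω * ∏ z ∈ T, s z ω)) := by
          refine Finset.sum_congr rfl fun ω _ => ?_
          rw [mul_assoc, betheCore_spin_cosh_expand s N ω (fun z hz => hs z hz ω) β hy,
            Finset.mul_sum, Finset.mul_sum]
          refine Finset.sum_congr rfl fun T _ => ?_
          ring
      _ = Real.cosh β ^ #N * ∑ T ∈ N.powerset,
            (if y ∈ T then (Real.tanh β ^ (#T - 1) + (-Real.tanh β) ^ (#T - 1)) / 2
              else (Real.tanh β ^ (#T + 1) + (-Real.tanh β) ^ (#T + 1)) / 2) *
              ∑ ω, E ω * g ω * ∏ z ∈ T, s z ω := by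
          rw [Finset.sum_comm, Finset.mul_sum]
          refine Finset.sum_congr rfl fun T _ => ?_
          rw [Finset.mul_sum, Finset.mul_sum]
  -- comparison of the coefficients
  calc (#N : ℝ) * ∑ ω, E ω * g ω * Real.sinh (β * ∑ y ∈ N, s y ω)
      = Real.cosh β ^ #N * ∑ S ∈ N.powerset,
          (#N : ℝ) * ((Real.tanh β ^ #S - (-Real.tanh β) ^ #S) / 2) *
            ∑ ω, E ω * g ω * ∏ y ∈ S, s y ω := by
        rw [hL, Finset.mul_sum, Finset.mul_sum, Finset.mul_sum]
        refine Finset.sum_congr rfl fun S _ => ?_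
        ring
    _ ≤ Real.cosh β ^ #N * ∑ S ∈ N.powerset,
          (∑ y ∈ N, (if y ∈ S then
              (Real.tanh β ^ (#S - 1) + (-Real.tanh β) ^ (#S - 1)) / 2
            else (Real.tanh β ^ (#S + 1) + (-Real.tanh β) ^ (#S + 1)) / 2)) *
            ∑ ω, E ω * g ω * ∏ y ∈ S, s y ω := by
        refine mul_le_mul_of_nonneg_left (Finset.sum_le_sum fun S hS => ?_) hc0
        exact mul_le_mul_of_nonneg_right
          (betheCore_coeff (Finset.mem_powerset.mp hS) ht0 ht1 ht)
          (hGKS S (Finset.mem_powerset.mp hS))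
    _ = ∑ y ∈ N, ∑ ω, E ω * g ω * s y ω * Real.cosh (β * ∑ z ∈ N, s z ω) := by
        rw [Finset.sum_congr rfl hR, ← Finset.mul_sum, Finset.sum_comm]
        congr 1
        refine Finset.sum_congr rfl fun S _ => ?_
        rw [Finset.sum_mul]

/-! ### Appendix (lead c1, 2026-08-17): the exact x-deleted odd-moment expansion

`bethe_core` is the sign consequence of the IDENTITY `bethe_identity`:
`Σ_{y∈N} Σ_ω E g s_y cosh(βh) − n Σ_ω E g sinh(βh) = cosh^n β · Σ_{T⊆N, #T odd} c_{#T}(t) · Σ_ω E g σ_T`,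
`c_k(t) = t^{k−1}(1−t)(k − (n−k)t)` (`t = tanh β`; `c_1 = (1−t)(1−(n−1)t)`, `c_3 = 3t²(1−t)(1−(n−3)t/3)`, …),
all nonnegative iff `(n−1)t ≤ 1` (Bethe threshold); above it exactly `c_1 < 0`.  This is the
"x-deleted odd-moment dominance" form of subharmonicity of `Cruxes/SubharmonicOffOrigin/STRATEGY-CENSUS.md`
§S4 (on `ℤ³` at `β_c`: SubH(x) ⟺ `(5t−1)(1−t)S₁ ≤ 3t²(1−t)²S₃ + t⁴(1−t)(5−t)S₅`, `S_k = Σ_{#T=k} ΣEσ₀σ_T`).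
-/

/-- The exact coefficient of the moment `M_T` in `Σ_y (s_y cosh βh) − n sinh βh`: zero for `#T` even,
`t^{#T−1}(1−t)(#T − (#N−#T)t)` for `#T` odd (`t = tanh β`). -/
private theorem betheCore_coeff_eq {W : Type*} [DecidableEq W] {N T : Finset W} (hT : T ⊆ N) (t : ℝ) :
    (∑ y ∈ N, (if y ∈ T then (t ^ (#T - 1) + (-t) ^ (#T - 1)) / 2
        else (t ^ (#T + 1) + (-t) ^ (#T + 1)) / 2)) - (#N : ℝ) * ((t ^ #T - (-t) ^ #T) / 2) =
      if Odd #T then t ^ (#T - 1) * (1 - t) * ((#T : ℝ) - ((#N : ℝ) - #T) * t) else 0 := by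
  rw [← Finset.sum_sdiff hT,
    Finset.sum_ite_of_false (s := N \ T) (p := fun y => y ∈ T)
      (fun y hy => (Finset.mem_sdiff.mp hy).2),
    Finset.sum_ite_of_true (s := T) (p := fun y => y ∈ T) (fun y hy => hy),
    Finset.sum_const, Finset.sum_const, nsmul_eq_mul, nsmul_eq_mul,
    Finset.card_sdiff_of_subset hT, Nat.cast_sub (Finset.card_le_card hT)]
  rcases Nat.even_or_odd #T with hk | hk
  · have ho1 : Odd (#T + 1) := hk.add_one
    rw [if_neg (Nat.not_odd_iff_even.2 hk), hk.neg_pow, ho1.neg_pow]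
    rcases Nat.eq_zero_or_pos #T with h0 | hpos
    · rw [h0]
      simp
    · have ho2 : Odd (#T - 1) := by
        obtain ⟨j, hj⟩ := hk
        exact ⟨j - 1, by omega⟩
      rw [ho2.neg_pow]
      ring
  · have hk1 : 1 ≤ #T := by
      obtain ⟨j, hj⟩ := hk
      omega
    have he1 : Even (#T - 1) := by
      obtain ⟨j, hj⟩ := hk
      exact ⟨j, by omega⟩
    have he2 : Even (#T + 1) := hk.add_one
    rw [if_pos hk, hk.neg_pow, he1.neg_pow, he2.neg_pow]
    have hp1 : t ^ #T = t ^ (#T - 1) * t := by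
      rw [← pow_succ, Nat.sub_add_cancel hk1]
    have hp2 : t ^ (#T + 1) = t ^ (#T - 1) * t * t := by
      rw [pow_succ, hp1]
    rw [hp2, hp1]
    ring

/-- Expansion of the weighted `sinh` sum over the moments `M_S = Σ_ω E g σ_S`. -/
private theorem betheCore_lhs_expand {Ω W : Type*} [Fintype Ω] (E g : Ω → ℝ) (s : W → Ω → ℝ)
    (N : Finset W) (hs : ∀ y ∈ N, ∀ ω, s y ω = 1 ∨ s y ω = -1) (β : ℝ) :
    ∑ ω, E ω * g ω * Real.sinh (β * ∑ y ∈ N, s y ω) =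
      Real.cosh β ^ #N * ∑ S ∈ N.powerset,
        (Real.tanh β ^ #S - (-Real.tanh β) ^ #S) / 2 * ∑ ω, E ω * g ω * ∏ y ∈ S, s y ω := by
  calc ∑ ω, E ω * g ω * Real.sinh (β * ∑ y ∈ N, s y ω)
      = ∑ ω, ∑ S ∈ N.powerset, Real.cosh β ^ #N *
          ((Real.tanh β ^ #S - (-Real.tanh β) ^ #S) / 2 *
            (E ω * g ω * ∏ y ∈ S, s y ω)) := by
        refine Finset.sum_congr rfl fun ω _ => ?_
        rw [betheCore_sinh_expand s N ω (fun y hy => hs y hy ω) β, Finset.mul_sum,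
          Finset.mul_sum]
        refine Finset.sum_congr rfl fun S _ => ?_
        ring
    _ = Real.cosh β ^ #N * ∑ S ∈ N.powerset,
          (Real.tanh β ^ #S - (-Real.tanh β) ^ #S) / 2 *
            ∑ ω, E ω * g ω * ∏ y ∈ S, s y ω := by
        rw [Finset.sum_comm, Finset.mul_sum]
        refine Finset.sum_congr rfl fun S _ => ?_
        rw [Finset.mul_sum, Finset.mul_sum]

/-- Expansion of the weighted `s_y cosh` sum over the moments `M_T = Σ_ω E g σ_T`. -/
private theorem betheCore_rhs_expand {Ω W : Type*} [Fintype Ω] [DecidableEq W] (E g : Ω → ℝ)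
    (s : W → Ω → ℝ) (N : Finset W) (hs : ∀ y ∈ N, ∀ ω, s y ω = 1 ∨ s y ω = -1) (β : ℝ)
    {y : W} (hy : y ∈ N) :
    ∑ ω, E ω * g ω * s y ω * Real.cosh (β * ∑ z ∈ N, s z ω) =
      Real.cosh β ^ #N * ∑ T ∈ N.powerset,
        (if y ∈ T then (Real.tanh β ^ (#T - 1) + (-Real.tanh β) ^ (#T - 1)) / 2
          else (Real.tanh β ^ (#T + 1) + (-Real.tanh β) ^ (#T + 1)) / 2) *
          ∑ ω, E ω * g ω * ∏ z ∈ T, s z ω := by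
  calc ∑ ω, E ω * g ω * s y ω * Real.cosh (β * ∑ z ∈ N, s z ω)
      = ∑ ω, ∑ T ∈ N.powerset, Real.cosh β ^ #N *
          ((if y ∈ T then (Real.tanh β ^ (#T - 1) + (-Real.tanh β) ^ (#T - 1)) / 2
            else (Real.tanh β ^ (#T + 1) + (-Real.tanh β) ^ (#T + 1)) / 2) *
            (E ω * g ω * ∏ z ∈ T, s z ω)) := by
        refine Finset.sum_congr rfl fun ω _ => ?_
        rw [mul_assoc, betheCore_spin_cosh_expand s N ω (fun z hz => hs z hz ω) β hy,
          Finset.mul_sum, Finset.mul_sum]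
        refine Finset.sum_congr rfl fun T _ => ?_
        ring
    _ = Real.cosh β ^ #N * ∑ T ∈ N.powerset,
          (if y ∈ T then (Real.tanh β ^ (#T - 1) + (-Real.tanh β) ^ (#T - 1)) / 2
            else (Real.tanh β ^ (#T + 1) + (-Real.tanh β) ^ (#T + 1)) / 2) *
            ∑ ω, E ω * g ω * ∏ z ∈ T, s z ω := by
        rw [Finset.sum_comm, Finset.mul_sum]
        refine Finset.sum_congr rfl fun T _ => ?_
        rw [Finset.mul_sum, Finset.mul_sum]

/-- **The x-deleted odd-moment expansion (exact form of `bethe_core`).** With `E` a weight on the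
finite set `Ω` of outer configurations, `g` an observable and `±1`-valued spins `s_y` (`y ∈ N`,
`n = #N`, `h = Σ_{y∈N} s_y`, `t = tanh β`, any real `β`):
`Σ_{y∈N} Σ_ω E g s_y cosh(βh) − n·Σ_ω E g sinh(βh) = cosh^n β · Σ_{T⊆N, #T odd} t^{#T−1}(1−t)(#T − (n−#T)t) · Σ_ω E g Π_{y∈T} s_y`.
In the Ising application (`PerfectScreeningSubharmonicOffOriginBetheThreshold.lean`) the left side is
`Z/2` times `Σ_{y∼x}⟨σ_oσ_y⟩ − deg x·⟨σ_oσ_x⟩`, and the inner sums are the unnormalised moments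
`⟨σ_oσ_T⟩` of the x-deleted system — so lattice subharmonicity of the two-point function at `x` is
EQUIVALENT to the weighted odd-moment inequality `Σ_{T odd} c_{#T}(t) M_T ≥ 0`,
`c_k(t) = t^{k−1}(1−t)(k−(n−k)t)`, whose coefficients are all nonnegative exactly up to the Bethe
threshold `(n−1)t ≤ 1` (finite high-temperature expansion, Friedli–Velenik 2017 eq. (3.44)). -/
theorem bethe_identity : ∀ {Ω W : Type*} [Fintype Ω] [DecidableEq W] (E g : Ω → ℝ) (s : W → Ω → ℝ) (N : Finset W), (∀ y ∈ N, ∀ ω, s y ω = 1 ∨ s y ω = -1) → ∀ β : ℝ, ∑ y ∈ N, ∑ ω, E ω * g ω * s y ω * Real.cosh (β * ∑ z ∈ N, s z ω) - (#N : ℝ) * ∑ ω, E ω * g ω * Real.sinh (β * ∑ y ∈ N, s y ω) = Real.cosh β ^ #N * ∑ T ∈ N.powerset.filter (fun T => Odd #T), Real.tanh β ^ (#T - 1) * (1 - Real.tanh β) * ((#T : ℝ) - ((#N : ℝ) - #T) * Real.tanh β) * ∑ ω, E ω * g ω * ∏ y ∈ T, s y ω := by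
  intro Ω W _ _ E g s N hs β
  -- abbreviations for the coefficients and the moments
  set t := Real.tanh β with ht
  set M : Finset W → ℝ := fun T => ∑ ω, E ω * g ω * ∏ y ∈ T, s y ω with hM
  set e' : W → Finset W → ℝ := fun y T =>
    if y ∈ T then (t ^ (#T - 1) + (-t) ^ (#T - 1)) / 2 else (t ^ (#T + 1) + (-t) ^ (#T + 1)) / 2
    with he'
  set o : Finset W → ℝ := fun T => (t ^ #T - (-t) ^ #T) / 2 with ho
  have hR : ∀ y ∈ N, ∑ ω, E ω * g ω * s y ω * Real.cosh (β * ∑ z ∈ N, s z ω) =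
      Real.cosh β ^ #N * ∑ T ∈ N.powerset, e' y T * M T := fun y hy =>
    betheCore_rhs_expand E g s N hs β hy
  have hL : ∑ ω, E ω * g ω * Real.sinh (β * ∑ y ∈ N, s y ω) =
      Real.cosh β ^ #N * ∑ T ∈ N.powerset, o T * M T := betheCore_lhs_expand E g s N hs β
  have hcoef : ∀ T ∈ N.powerset, (∑ y ∈ N, e' y T) - (#N : ℝ) * o T =
      if Odd #T then t ^ (#T - 1) * (1 - t) * ((#T : ℝ) - ((#N : ℝ) - #T) * t) else 0 :=
    fun T hT => betheCore_coeff_eq (Finset.mem_powerset.mp hT) t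
  rw [Finset.sum_congr rfl hR, hL, ← Finset.mul_sum, Finset.sum_comm]
  have key : ∀ (c n : ℝ) (A B : Finset W → ℝ) (S : Finset (Finset W)),
      c * ∑ T ∈ S, A T - n * (c * ∑ T ∈ S, B T) = c * ∑ T ∈ S, (A T - n * B T) := by
    intro c n A B S
    simp only [Finset.mul_sum]
    rw [← Finset.sum_sub_distrib]
    exact Finset.sum_congr rfl fun T _ => by ring
  have h1 : Real.cosh β ^ #N * ∑ T ∈ N.powerset, ∑ y ∈ N, e' y T * M T -
      (#N : ℝ) * (Real.cosh β ^ #N * ∑ T ∈ N.powerset, o T * M T) =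
      Real.cosh β ^ #N * ∑ T ∈ N.powerset, ((∑ y ∈ N, e' y T) - (#N : ℝ) * o T) * M T := by
    rw [key]
    congr 1
    refine Finset.sum_congr rfl fun T _ => ?_
    rw [sub_mul, Finset.sum_mul]
    ring
  rw [h1, Finset.sum_filter]
  congr 1
  refine Finset.sum_congr rfl fun T hT => ?_
  rw [hcoef T hT]
  split_ifs
  · rfl
  · rw [zero_mul]

end Summit.CriticalPhenomena.Ising3DConformalLimit.Theorems.PerfectScreening.Bethe

end
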